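import Mathlib
import Summits.AtomisticToContinuum.FouriersLaw.Theorems.EmbeddedDrudeMourreKineticConductivityFiniteSymmetry
import HarnessLib

/-!
# `EmbeddedDrudeMourre.KineticConductivityFinite` — measurability of the fibre sums and
`q(f_odd) ≤ q(f)`

Helper file (supports item `stmt-AtomisticToContinuum-12599`, route `EmbeddedDrudeMourre`, sub-problem
`FouriersLaw`).

* `finsum_mem_eq_sum_div_count` — a finite sum over a set `R` covered by a finite family `c : ι → ℝ`
  is the family sum weighted by inverse multiplicities (bookkeeping for `Finset.sum_comp`);
* `exists_measurable_repr` — for measurable `f`, the fibre sum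
  `(k₁, k₃) ↦ Σ_{k₂ ∈ resonantSet} w (f k₁ + f k₂ - f k₃ - f k₄)²` agrees on the cell with a jointly
  measurable function (the twelve candidates of `mem_candidates` uniformise the fibres);
* `boltzmannForm_oddPart_le` — **`q(f_odd) ≤ q(f)`** for `2π`-periodic measurable `f`: the
  parallelogram bound `two_mul_finsum_oddPart_le`, the reflection `finsum_reflect`, reflection
  invariance of the cell `setLIntegral_cell_neg`, and additivity of the lower integral (which is
  where measurability is needed).

References: Aoki–Lukkarinen–Spohn 2006 §4; Lukkarinen–Spohn 2008 Prop. 2.4 (parity of the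
linearised collision operator).
-/

noncomputable section

open Real Set MeasureTheory
open scoped ENNReal

namespace Summit.AtomisticToContinuum.FouriersLaw.Theorems.KineticConductivityFinite

open Literature.MathematicalPhysics.KineticTheory.PhononBoltzmann

/-! ### 1. Sums over a covered finite set -/

/-- A finite sum over `R ⊆ range c` (`c : ι → ℝ`, `ι` finite) equals the sum over the family of the
terms on `R`, each divided by its multiplicity in the family. [folklore] -/
theorem finsum_mem_eq_sum_div_count {ι : Type*} [Fintype ι] (c : ι → ℝ) {R : Set ℝ}
    [DecidablePred (· ∈ R)] (hR : R ⊆ Set.range c) (g : ℝ → ℝ) :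
    ∑ᶠ y ∈ R, g y =
      ∑ i, (if c i ∈ R then g (c i) else 0) / ∑ j, (if c j = c i then (1 : ℝ) else 0) := by
  classical
  have hfin : R.Finite := (Set.finite_range c).subset hR
  set F : ℝ → ℝ := fun y => (if y ∈ R then g y else 0) / ∑ j, (if c j = y then (1 : ℝ) else 0)
    with hF
  change ∑ᶠ y ∈ R, g y = ∑ i, F (c i)
  rw [Finset.sum_comp F c]
  have hterm : ∀ y ∈ Finset.univ.image c,
      (Finset.univ.filter (fun i => c i = y)).card • F y = if y ∈ R then g y else 0 := by
    intro y hy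
    have hm : (∑ j, if c j = y then (1 : ℝ) else 0) =
        ((Finset.univ.filter (fun i => c i = y)).card : ℝ) := by
      rw [Finset.sum_boole]
    have hpos : (0 : ℝ) < (Finset.univ.filter (fun i => c i = y)).card := by
      obtain ⟨i, -, rfl⟩ := Finset.mem_image.1 hy
      exact_mod_cast Finset.card_pos.2 ⟨i, by simp⟩
    rw [hF]
    simp only [hm, nsmul_eq_mul]
    rw [mul_div_cancel₀ _ hpos.ne']
  rw [Finset.sum_congr rfl hterm, ← Finset.sum_filter, finsum_mem_eq_finite_toFinset_sum _ hfin]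
  apply Finset.sum_congr _ fun _ _ => rfl
  ext y
  simp only [Set.Finite.mem_toFinset, Finset.mem_filter, Finset.mem_image, Finset.mem_univ,
    true_and]
  exact ⟨fun h => ⟨hR h, h⟩, fun h => h.2⟩

/-! ### 2. A measurable representative of the fibre sum -/

/-- **Measurable representative.** For `ω₂ > 0` and measurable `f`, the fibre sum
`(k₁, k₃) ↦ Σ_{k₂ ∈ resonantSet ω₂ k₁ k₃} w_{a,b}(k₁,k₂,k₃) (f k₁ + f k₂ - f k₃ - f(k₁+k₂-k₃))²`
coincides on the cell `(-π,π]²` with a measurable function of `(k₁, k₃)` (zero on the diagonal, and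
off it the inverse-multiplicity sum over the twelve measurable candidate maps of `mem_candidates`).
[folklore] -/
theorem exists_measurable_repr {ω₂ : ℝ} (hω : 0 < ω₂) (a b : ℝ) {f : ℝ → ℝ} (hf : Measurable f) :
    ∃ M : ℝ × ℝ → ℝ, Measurable M ∧ ∀ k₁ ∈ Ioc (-π) π, ∀ k₃ ∈ Ioc (-π) π,
      (∑ᶠ k₂ ∈ resonantSet ω₂ k₁ k₃, collisionWeight ω₂ a b k₁ k₂ k₃ *
        (f k₁ + f k₂ - f k₃ - f (k₁ + k₂ - k₃)) ^ 2) = M (k₁, k₃) := by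
  classical
  -- the two admissible cosines and the twelve candidates, as functions of `p = (k₁, k₃)`
  obtain ⟨T, hT⟩ : ∃ T : ℝ × ℝ → Bool → ℝ, T = fun p t => if t then Real.cos ((p.1 + p.2) / 2) else
      Real.cos ((p.1 - p.2) / 2) * (dispersion ω₂ p.1 - dispersion ω₂ p.2) ^ 2 /
        (2 * Real.sin ((p.1 - p.2) / 2) ^ 2) - Real.cos ((p.1 + p.2) / 2) := ⟨_, rfl⟩
  obtain ⟨cand, hcand⟩ : ∃ cand : ℝ × ℝ → (Bool × (({1, -1} : Finset ℝ))) × (({-1, 0, 1} : Finset ℝ)) → ℝ,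
      cand = fun p i => (i.1.2 : ℝ) * Real.arccos (T p i.1.1) - (p.1 - p.2) / 2 + 2 * (i.2 : ℝ) * π :=
    ⟨_, rfl⟩
  have hT_meas : ∀ t, Measurable fun p => T p t := by
    intro t
    cases t
    · simp only [hT, Bool.false_eq_true, if_false]
      unfold dispersion
      fun_prop
    · simp only [hT, if_true]
      fun_prop
  have hcand_meas : ∀ i, Measurable fun p => cand p i := by
    intro i
    simp only [hcand]
    have := hT_meas i.1.1
    fun_prop
  have hmem : ∀ i, MeasurableSet {p : ℝ × ℝ | cand p i ∈ resonantSet ω₂ p.1 p.2} := by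
    intro i
    have hΩ : Measurable fun p : ℝ × ℝ => resonanceFn ω₂ p.1 (cand p i) p.2 := by
      have := hcand_meas i
      unfold resonanceFn dispersion
      fun_prop
    have : {p : ℝ × ℝ | cand p i ∈ resonantSet ω₂ p.1 p.2} =
        (fun p => cand p i) ⁻¹' Ioc (-π) π ∩ {p | resonanceFn ω₂ p.1 (cand p i) p.2 = 0} := by
      ext p; simp [resonantSet]
    rw [this]
    exact (measurableSet_Ioc.preimage (hcand_meas i)).inter
      (measurableSet_eq_fun hΩ measurable_const)
  have hbranch : ∀ i, Measurable fun p : ℝ × ℝ => collisionWeight ω₂ a b p.1 (cand p i) p.2 *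
      (f p.1 + f (cand p i) - f p.2 - f (p.1 + cand p i - p.2)) ^ 2 := by
    intro i
    have := hcand_meas i
    unfold collisionWeight resonanceJacobian groupVelocity vertex dispersion
    fun_prop
  have hsummand : ∀ i, Measurable fun p : ℝ × ℝ =>
      (if cand p i ∈ resonantSet ω₂ p.1 p.2 then collisionWeight ω₂ a b p.1 (cand p i) p.2 *
          (f p.1 + f (cand p i) - f p.2 - f (p.1 + cand p i - p.2)) ^ 2 else 0) /
        ∑ j, (if cand p j = cand p i then (1 : ℝ) else 0) := by
    intro i
    refine Measurable.div (Measurable.ite (hmem i) (hbranch i) measurable_const) ?_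
    exact Finset.measurable_sum _ fun j _ =>
      Measurable.ite (measurableSet_eq_fun (hcand_meas j) (hcand_meas i)) measurable_const
        measurable_const
  have hM : Measurable fun p : ℝ × ℝ => if p.1 = p.2 then (0 : ℝ) else
      ∑ i, (if cand p i ∈ resonantSet ω₂ p.1 p.2 then collisionWeight ω₂ a b p.1 (cand p i) p.2 *
          (f p.1 + f (cand p i) - f p.2 - f (p.1 + cand p i - p.2)) ^ 2 else 0) /
        ∑ j, (if cand p j = cand p i then (1 : ℝ) else 0) :=
    Measurable.ite (measurableSet_eq_fun measurable_fst measurable_snd) measurable_const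
      (Finset.measurable_sum _ fun i _ => hsummand i)
  refine ⟨_, hM, ?_⟩
  intro k₁ hk₁ k₃ hk₃
  by_cases hdiag : k₁ = k₃
  · subst hdiag
    rw [if_pos rfl]
    apply finsum_mem_of_eqOn_zero
    intro k₂ _
    simp only [add_sub_cancel_left, Pi.zero_apply]
    ring
  rw [if_neg hdiag]
  have hR : resonantSet ω₂ k₁ k₃ ⊆ Set.range (cand (k₁, k₃)) := by
    intro k₂ hk₂
    obtain ⟨t, ht, σ, hσ, n, hn, hk⟩ := mem_candidates hω hk₁ hk₃ hdiag hk₂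
    simp only [Finset.mem_insert, Finset.mem_singleton] at ht
    rcases ht with rfl | rfl
    · exact ⟨((true, ⟨σ, hσ⟩), ⟨n, hn⟩), by simp only [hcand, hT, if_true]; rw [hk]⟩
    · exact ⟨((false, ⟨σ, hσ⟩), ⟨n, hn⟩), by
        simp only [hcand, hT, Bool.false_eq_true, if_false]; rw [hk]⟩
  exact finsum_mem_eq_sum_div_count (cand (k₁, k₃)) hR _

/-! ### 3. `q(f_odd) ≤ q(f)` -/

/-- **Abstract parity bound for iterated lower integrals over the cell.** If `2·S_o ≤ S_f + S_n`
pointwise on the cell, `S_n(k₁,k₃) = S_f(-k₁,-k₃)`, `S_f, S_n ≥ 0`, and `S_f` agrees on the cell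
with a measurable function, then `∫⁻∫⁻ S_o ≤ ∫⁻∫⁻ S_f` (reflection invariance of the cell and
additivity of the lower integral for a.e.-measurable integrands). [folklore] -/
theorem lintegral_parity_bound {So Sf Sn : ℝ → ℝ → ℝ} {M : ℝ × ℝ → ℝ} (hM : Measurable M)
    (hSM : ∀ k₁ ∈ Ioc (-π) π, ∀ k₃ ∈ Ioc (-π) π, Sf k₁ k₃ = M (k₁, k₃))
    (hf0 : ∀ k₁ k₃, 0 ≤ Sf k₁ k₃) (hn0 : ∀ k₁ k₃, 0 ≤ Sn k₁ k₃)
    (h5 : ∀ k₁ ∈ Ioc (-π) π, ∀ k₃ ∈ Ioc (-π) π, 2 * So k₁ k₃ ≤ Sf k₁ k₃ + Sn k₁ k₃)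
    (h1 : ∀ k₁ k₃, Sn k₁ k₃ = Sf (-k₁) (-k₃)) :
    ∫⁻ k₁ in Ioc (-π) π, ∫⁻ k₃ in Ioc (-π) π, ENNReal.ofReal (So k₁ k₃) ≤
      ∫⁻ k₁ in Ioc (-π) π, ∫⁻ k₃ in Ioc (-π) π, ENNReal.ofReal (Sf k₁ k₃) := by
  have h2top : (2 : ℝ≥0∞) ≠ ⊤ := ENNReal.ofNat_ne_top
  -- a.e.-measurability of the inner integrand and of the inner integral
  have hAEM₃ : ∀ k₁ ∈ Ioc (-π) π,
      AEMeasurable (fun k₃ => ENNReal.ofReal (Sf k₁ k₃)) (volume.restrict (Ioc (-π) π)) := by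
    intro k₁ hk₁
    have hm : Measurable fun k₃ => ENNReal.ofReal (M (k₁, k₃)) :=
      ENNReal.measurable_ofReal.comp (hM.comp (measurable_const.prodMk measurable_id))
    refine hm.aemeasurable.congr ?_
    filter_upwards [ae_restrict_mem measurableSet_Ioc] with k₃ hk₃
    rw [hSM k₁ hk₁ k₃ hk₃]
  have hAEM₁ : AEMeasurable (fun k₁ => ∫⁻ k₃ in Ioc (-π) π, ENNReal.ofReal (Sf k₁ k₃))
      (volume.restrict (Ioc (-π) π)) := by
    have hm : Measurable fun k₁ => ∫⁻ k₃ in Ioc (-π) π, ENNReal.ofReal (M (k₁, k₃)) :=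
      (ENNReal.measurable_ofReal.comp hM).lintegral_prod_right'
    refine hm.aemeasurable.congr ?_
    filter_upwards [ae_restrict_mem measurableSet_Ioc] with k₁ hk₁
    apply setLIntegral_congr_fun measurableSet_Ioc
    intro k₃ hk₃
    simp only []
    rw [hSM k₁ hk₁ k₃ hk₃]
  -- the doubled inequality
  have key : 2 * ∫⁻ k₁ in Ioc (-π) π, ∫⁻ k₃ in Ioc (-π) π, ENNReal.ofReal (So k₁ k₃) ≤
      (∫⁻ k₁ in Ioc (-π) π, ∫⁻ k₃ in Ioc (-π) π, ENNReal.ofReal (Sf k₁ k₃)) +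
        ∫⁻ k₁ in Ioc (-π) π, ∫⁻ k₃ in Ioc (-π) π, ENNReal.ofReal (Sf k₁ k₃) := by
    calc 2 * ∫⁻ k₁ in Ioc (-π) π, ∫⁻ k₃ in Ioc (-π) π, ENNReal.ofReal (So k₁ k₃)
        = ∫⁻ k₁ in Ioc (-π) π, ∫⁻ k₃ in Ioc (-π) π, 2 * ENNReal.ofReal (So k₁ k₃) := by
          rw [← lintegral_const_mul' _ _ h2top]
          congr 1; funext k₁
          rw [← lintegral_const_mul' _ _ h2top]
      _ ≤ ∫⁻ k₁ in Ioc (-π) π, ∫⁻ k₃ in Ioc (-π) π,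
            (ENNReal.ofReal (Sf k₁ k₃) + ENNReal.ofReal (Sf (-k₁) (-k₃))) := by
          apply setLIntegral_mono' measurableSet_Ioc; intro k₁ hk₁
          apply setLIntegral_mono' measurableSet_Ioc; intro k₃ hk₃
          calc 2 * ENNReal.ofReal (So k₁ k₃) = ENNReal.ofReal (2 * So k₁ k₃) := by
                rw [ENNReal.ofReal_mul zero_le_two, ENNReal.ofReal_ofNat]
            _ ≤ ENNReal.ofReal (Sf k₁ k₃ + Sn k₁ k₃) := ENNReal.ofReal_le_ofReal (h5 k₁ hk₁ k₃ hk₃)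
            _ = ENNReal.ofReal (Sf k₁ k₃) + ENNReal.ofReal (Sn k₁ k₃) :=
                ENNReal.ofReal_add (hf0 k₁ k₃) (hn0 k₁ k₃)
            _ = _ := by rw [h1]
      _ = ∫⁻ k₁ in Ioc (-π) π, ((∫⁻ k₃ in Ioc (-π) π, ENNReal.ofReal (Sf k₁ k₃)) +
            ∫⁻ k₃ in Ioc (-π) π, ENNReal.ofReal (Sf (-k₁) (-k₃))) := by
          apply setLIntegral_congr_fun measurableSet_Ioc; intro k₁ hk₁
          exact lintegral_add_left' (hAEM₃ k₁ hk₁) _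
      _ = ∫⁻ k₁ in Ioc (-π) π, ((∫⁻ k₃ in Ioc (-π) π, ENNReal.ofReal (Sf k₁ k₃)) +
            ∫⁻ k₃ in Ioc (-π) π, ENNReal.ofReal (Sf (-k₁) k₃)) := by
          congr 1; funext k₁
          rw [setLIntegral_cell_neg (fun k₃ => ENNReal.ofReal (Sf (-k₁) k₃))]
      _ = (∫⁻ k₁ in Ioc (-π) π, ∫⁻ k₃ in Ioc (-π) π, ENNReal.ofReal (Sf k₁ k₃)) +
            ∫⁻ k₁ in Ioc (-π) π, ∫⁻ k₃ in Ioc (-π) π, ENNReal.ofReal (Sf (-k₁) k₃) :=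
          lintegral_add_left' hAEM₁ _
      _ = _ := by
          rw [setLIntegral_cell_neg (fun k₁ => ∫⁻ k₃ in Ioc (-π) π, ENNReal.ofReal (Sf k₁ k₃))]
  rw [← two_mul] at key
  exact (ENNReal.mul_le_mul_iff_right two_ne_zero h2top).1 key

/-- **Parity: `q(f_odd) ≤ q(f)`** for `2π`-periodic measurable `f`, `f_odd(k) = (f(k) - f(-k))/2`:
ALS's form is invariant under momentum reversal and midpoint-convex, so the odd part never has a
larger form. [cite: LukkarinenSpohn2008, Def. 2.3 and Prop. 2.4] -/
theorem boltzmannForm_oddPart_le {ω₂ : ℝ} (hω : 0 < ω₂) (a b : ℝ) {f : ℝ → ℝ}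
    (hper : Function.Periodic f (2 * π)) (hmeas : Measurable f) :
    boltzmannForm ω₂ a b (fun k => (f k - f (-k)) / 2) ≤ boltzmannForm ω₂ a b f := by
  obtain ⟨M, hM, hSM⟩ := exists_measurable_repr hω a b hmeas
  unfold boltzmannForm
  gcongr ENNReal.ofReal (1 / 4) * ?_
  exact lintegral_parity_bound hM hSM
    (fun k₁ k₃ => finsum_mem_nonneg' fun k₂ =>
      mul_nonneg (collisionWeight_nonneg ω₂ a b k₁ k₂ k₃) (sq_nonneg _))
    (fun k₁ k₃ => finsum_mem_nonneg' fun k₂ =>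
      mul_nonneg (collisionWeight_nonneg ω₂ a b k₁ k₂ k₃) (sq_nonneg _))
    (fun k₁ hk₁ k₃ hk₃ => two_mul_finsum_oddPart_le hω a b f hk₁ hk₃)
    (fun k₁ k₃ => finsum_reflect a b hper k₁ k₃)

end Summit.AtomisticToContinuum.FouriersLaw.Theorems.KineticConductivityFinite

end
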